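import Mathlib
import Literature.AlgebraicGeometry.Resolution.CobordantGame
import Summits.ResolutionOfSingularities.ResolutionOfSingularities.Theorems.WeightedInvariantLocalWeightedDropCharTwoDoublePointReduction
import Summits.ResolutionOfSingularities.ResolutionOfSingularities.Theorems.WeightedInvariantLocalWeightedDropWeierstrassForm

/-!
# The wild residual W4 at order 2 (char-2 double points in `≥ 4` variables) is the MONIC DOUBLE-POINT game one dimension down

[OURS · L1 W4.3 · chain w43, SEAT TABLE v6.1 row stub-4 «W4/T″ at N = 4»; stub worker 4] Engine crux `LocalWeightedDrop`
(stmt-ResolutionOfSingularities-8899), registered skeleton v29: residual stubs W4|₄ `stub_wildWideApexFourStartsWon` / W4|₅₊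
`stub_wildWideApexFiveUpStartsWon` (res-L1-w43-strat-1's split of v28's `stub_wildWideApexHigherStartsWon`).  NOT a statement of any
manuscript; the game is the programme's own.

The `d = 2` slice of W4 in `n + 4` variables (then `p = 2`, tangent quadric a square `ℓ²`): exactly as stub worker 3 cut the `N = 3`
piece S2 (`charTwoDoublePointSurfaceWon_of_normalForms` / `…_of_monicForms`), the dimension-generic normal form
`UnaryConeForm.normalForm_of_sq` + `normalFormsWon_of_monicFormsWon` reduce it to the CHAR-2 MONIC DOUBLE POINTS
`y² + A₁(x) y + A₀(x)`, `A_i ∈ k⟦x_0,…,x_{n+2}⟧`, `ord A₁ ≥ 2`, `ord A₀ ≥ 3`, won in `n + 4` variables: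
`wildWideApexHigherStartsWon_two_of_monicForms`, and its `N = 4` instance `wildWideApexFourStartsWon_two_of_monicForms`
(conclusions = the `d = 2` slices of the registered signatures, other hypotheses passed through).  A TYPED CUT for the planners
(the honest frontier: `A₁ = 0` = purely inseparable threefold double points `y² + A₀(x₀,x₁,x₂)` in characteristic 2), not a proof.
-/

set_option linter.dupNamespace false -- mandated namespace of this single-conjunct summit

namespace Summit.ResolutionOfSingularities.ResolutionOfSingularities.Theorems

open Literature.AlgebraicGeometry.Resolution Literature.AlgebraicGeometry.Resolution.CobordantGame

/-- **W4 ∩ {d = 2} FROM THE CHAR-2 MONIC DOUBLE POINTS ONE DIMENSION DOWN** (every `N = n + 4 ≥ 4`): if every monic double point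
`y² + A₁ y + A₀` over `k⟦x_0,…,x_{n+2}⟧` (`ord A₁ ≥ 2`, `ord A₀ ≥ 3`) is won in `n + 4` variables (given the singular germs in fewer
variables), then every singular germ of order `2` with square tangent quadric in `n + 4` variables over an algebraically closed field
of characteristic `p ∣ 2` is won — the `d = 2` slice of `stub_wildWideApexHigherStartsWon` (v28) / of W4|₄, W4|₅₊ (v29).
[OURS · L1 W4.3; proof of a slice of the stub WITH AN EXTRA HYPOTHESIS] -/
theorem wildWideApexHigherStartsWon_two_of_monicForms
    (hmonic : ∀ (k : Type) [Field k] [CharP k 2] [IsAlgClosed k] (n : ℕ),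
      (∀ m : ℕ, m < n + 4 → ∀ g : MvPowerSeries (Fin m) k,
        CobordantGame.IsSingular k g → CobordantGame.Won k m g) →
      ∀ (A₀ A₁ : MvPowerSeries (Fin (n + 3)) k), (2 : ℕ∞) < A₀.order → (1 : ℕ∞) < A₁.order →
        CobordantGame.Won k (n + 4) (MvPowerSeries.X (Fin.last (n + 3)) ^ 2 +
          (MvPowerSeries.rename (Fin.succAboveEmb (Fin.last (n + 3))) A₀ +
            MvPowerSeries.rename (Fin.succAboveEmb (Fin.last (n + 3))) A₁ * MvPowerSeries.X (Fin.last (n + 3))))) :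
    ∀ (p : ℕ), p.Prime → ∀ (k : Type) [Field k] [CharP k p] [IsAlgClosed k]
      (n : ℕ), (∀ m : ℕ, m < n + 4 → ∀ g : MvPowerSeries (Fin m) k,
        CobordantGame.IsSingular k g → CobordantGame.Won k m g) →
      ∀ (f : MvPowerSeries (Fin (n + 4)) k), CobordantGame.IsSingular k f →
      (∀ g : MvPowerSeries (Fin (n + 4)) k, CobordantGame.IsSingular k g → g.order < f.order →
        CobordantGame.Won k (n + 4) g) →
      f.order = 2 → p ∣ 2 →
      (∃ ℓ : Fin (n + 4) → k, ∀ i j : Fin (n + 4),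
        MvPowerSeries.coeff (Finsupp.single i 1 + Finsupp.single j 1) f =
          MvPowerSeries.coeff (Finsupp.single i 1 + Finsupp.single j 1)
            ((∑ l, MvPowerSeries.C (ℓ l) * MvPowerSeries.X l) ^ 2)) →
      CobordantGame.Won k (n + 4) f := by
  intro p hp k _ _ _ n IH f _ _ hf2 hpd hsq
  have hp2 : p = 2 := (Nat.prime_dvd_prime_iff_eq hp Nat.prime_two).mp hpd
  subst hp2
  obtain ⟨ℓ, hℓ⟩ := hsq
  obtain ⟨M, U, a₀, a₁, hMdet, hU, ha₀, ha₁, hfeq⟩ := UnaryConeForm.normalForm_of_sq f hf2 ℓ hℓ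
  have hW := normalFormsWon_of_monicFormsWon (m := n + 3) (hmonic k n) IH U a₀ a₁ hU ha₀ ha₁
  rw [← hfeq] at hW
  exact (won_subst_iff (ConeDichotomy.constantCoeff_linSubst M) (by rw [FormalCoordChange.linMat, ConeDichotomy.linMat_linSubst]; exact hMdet) f).mp hW

/-- **The `N = 4` instance**: char-2 monic double points `y² + A₁(x₀,x₁,x₂) y + A₀(x₀,x₁,x₂)` won in four variables ⇒ the `d = 2`
slice of W4|₄ `stub_wildWideApexFourStartsWon` (threefold hypersurface double points in characteristic 2). [OURS · L1 W4.3] -/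
theorem wildWideApexFourStartsWon_two_of_monicForms
    (hmonic : ∀ (k : Type) [Field k] [CharP k 2] [IsAlgClosed k],
      (∀ m : ℕ, m < 4 → ∀ g : MvPowerSeries (Fin m) k,
        CobordantGame.IsSingular k g → CobordantGame.Won k m g) →
      ∀ (A₀ A₁ : MvPowerSeries (Fin 3) k), (2 : ℕ∞) < A₀.order → (1 : ℕ∞) < A₁.order →
        CobordantGame.Won k 4 (MvPowerSeries.X (Fin.last 3) ^ 2 +
          (MvPowerSeries.rename (Fin.succAboveEmb (Fin.last 3)) A₀ +
            MvPowerSeries.rename (Fin.succAboveEmb (Fin.last 3)) A₁ * MvPowerSeries.X (Fin.last 3)))) :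
    ∀ (p : ℕ), p.Prime → ∀ (k : Type) [Field k] [CharP k p] [IsAlgClosed k],
      (∀ m : ℕ, m < 4 → ∀ g : MvPowerSeries (Fin m) k,
        CobordantGame.IsSingular k g → CobordantGame.Won k m g) →
      ∀ (f : MvPowerSeries (Fin 4) k), CobordantGame.IsSingular k f →
      (∀ g : MvPowerSeries (Fin 4) k, CobordantGame.IsSingular k g → g.order < f.order →
        CobordantGame.Won k 4 g) →
      f.order = 2 → p ∣ 2 →
      (∃ ℓ : Fin 4 → k, ∀ i j : Fin 4,
        MvPowerSeries.coeff (Finsupp.single i 1 + Finsupp.single j 1) f =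
          MvPowerSeries.coeff (Finsupp.single i 1 + Finsupp.single j 1)
            ((∑ l, MvPowerSeries.C (ℓ l) * MvPowerSeries.X l) ^ 2)) →
      CobordantGame.Won k 4 f := by
  intro p hp k _ _ _ IH f _ _ hf2 hpd hsq
  have hp2 : p = 2 := (Nat.prime_dvd_prime_iff_eq hp Nat.prime_two).mp hpd
  subst hp2
  obtain ⟨ℓ, hℓ⟩ := hsq
  obtain ⟨M, U, a₀, a₁, hMdet, hU, ha₀, ha₁, hfeq⟩ := UnaryConeForm.normalForm_of_sq f hf2 ℓ hℓ
  have hW := normalFormsWon_of_monicFormsWon (m := 3) (hmonic k) IH U a₀ a₁ hU ha₀ ha₁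
  rw [← hfeq] at hW
  exact (won_subst_iff (ConeDichotomy.constantCoeff_linSubst M) (by rw [FormalCoordChange.linMat, ConeDichotomy.linMat_linSubst]; exact hMdet) f).mp hW

end Summit.ResolutionOfSingularities.ResolutionOfSingularities.Theorems
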